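import Summits.ResolutionOfSingularities.ResolutionOfSingularities.Theorems.MarkedTransferCampaignW21AlongCentreRefutation
import Mathlib.Algebra.CharP.Lemmas
import Mathlib.Algebra.CharP.Algebra
import HarnessLib

/-!
# [OURS · L1 W2.1] The TWO-LEVEL chain witness (series level): `ε₀ = y^{p²−1}u^{p²+1}v^{p²} + y^{p²−1}u v^{2p²} + u^{p²}v^{p³+p²+p}`,
# `H♭(ε₀) = ε₀ + v^{p(p+1)²}`, `ε₁ = −v^{(p+1)²}`, and the chain `y^{p²} + ε₀ = (y^p + ε₁)^p + H♭(ε₀)` in `𝔽_p⟦y, u, v⟧`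

Rung L (rescue) of cell res-hironaka, RESCUE-SEED row L-G2, slot W2.1 (USE half), seat res-L1-s21-pv-1 (gen 2). The one-level
witness (`…AlongCentreWitness.lean` p500590, `…AlongCentreRefutation.lean` p501112) shows that the D-adic inequality the proof
of Lem. 16.7 consumes (p.85 L10–L11 of the manuscript under adjudication) fails on class-safe data along a line `D`, but
leaves the CHAIN COUPLING of p.85 L2 («D ⊂ ∇ = {g(e) = 0}») unmodelled; at `e = 1` that coupling makes the lemma automatic
(chain step, p500718). THIS FILE and its companions (`…ChainWitness.lean`, `…ChainCentre.lean`) supply a TWO-LEVEL datum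
(`e = 2`) in which the coupling holds and the transfer «D permissible for F̌(0) ⇒ D permissible for F̌(1)» still FAILS, for
EVERY prime `p`, in `R = 𝔽_p⟦y, u, v⟧` (`y = X 0`, `u = X 1`, `v = X 2`):
* level 0 (`q = p²`): `ε₀ = y^{p²−1}u^{p²+1}v^{p²} + y^{p²−1}u v^{2p²} + u^{p²}v^{p³+p²+p}` (a `MinDegreeTop` datum in Case (I)
  only, `…ChainWitness.lean`); `∂^{(p²−1,1,0)}ε₀ = u^{p²}v^{p²} + v^{2p²}`, `∂^{(0,p²,p²)}ε₀ = y^{p²−1}u + v^{p³+p}`, so the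
  Case-(I) value is `h₀ = H♭(ε₀) = ε₀ + v^{p³+2p²+p}` and the remainder `ε₀ − h₀ = −v^{p(p+1)²} = (ε₁)^p` is a `p`-th power;
* level 1 (`q = p`): `ε₁ = −v^{(p+1)²}`, a single unit-monomial term whose Case-(I) value is `H♭(ε₁) = ε₁` (so `h₁ = ε₁` and
  the chain ends with `g(2) = y`, `∇ = V(y)`);
* the chain identities `g(0) = y^{p²} + ε₀ = (y^p + ε₁)^p + h₀ = g(1)^p + h₀`, `g(1) = y^p + ε₁ = g(2)^p + h₁`;
* along the smooth line `D = V(y, u)` (`P = (X 0, X 1)`, `…AlongCentreRefutation.lean`), which lies INSIDE `∇ = V(y)`: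
  `g(0) ∈ P^{p²}` (D permissible for `F̌(0) = (g(0), p²)`) but `g(1) ∉ P` (`ord_D g(1) = 0 < p`: D NOT permissible for
  `F̌(1) = (g(1), p)`), and `h₀ ∉ P`.
Everything here is OURS / folklore about OURS data; nothing is a statement of or about the manuscript (whether these data
instantiate row 019's scheme-level `LLChain` — with its PLACEHOLDER memberships `calP`, `nega` — is for the typers and the
adjudicators of row 095 / R08, not claimed here); AI review is weaker than expert review.
-/

noncomputable section

set_option linter.dupNamespace false -- mandated namespace of this single-conjunct summit

namespace Summit.ResolutionOfSingularities.ResolutionOfSingularities.Theorems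

namespace CampaignW21

open Literature.AlgebraicGeometry.Hironaka2017.S08UnitMonomial
open Literature.AlgebraicGeometry.Hironaka2017.S09LLUED
open Literature.AlgebraicGeometry.Hironaka2017.S09LLUED.TopFrontier
open Literature.AlgebraicGeometry.Resolution
open Literature.RingTheory.MvPowerSeries
open MvPowerSeries Finsupp

namespace ChainWitness

open AlongCentreWitness

variable (p : ℕ) [hp : Fact p.Prime]

/-- The `y`-exponent `M = (p−1) + p(p−1) = p² − 1` of the top block (digits `a_y = b_y = p − 1`). [folklore] -/
def M : ℕ := (p - 1) + p * (p - 1)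

/-- `M + 1 = p²`. [folklore] -/
theorem M_add_one : M p + 1 = p ^ 2 := by
  obtain ⟨k, hk⟩ : ∃ k, p = k + 1 := ⟨p - 1, by have := hp.out.one_lt; omega⟩
  rw [M, hk, Nat.add_sub_cancel]; ring

/-- The level-0 witness `ε₀ = y^{M}u^{p²+1}v^{p²} + y^{M}u v^{2p²} + u^{p²}v^{p³+p²+p}`, `M = p² − 1`. [folklore] -/
def eps0 : R p :=
  X 0 ^ M p * X 1 ^ (p ^ 2 + 1) * X 2 ^ (p ^ 2) + X 0 ^ M p * X 1 * X 2 ^ (2 * p ^ 2) +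
    X 1 ^ (p ^ 2) * X 2 ^ (p ^ 3 + p ^ 2 + p)

/-- The level-1 witness `ε₁ = −v^{(p+1)²}` (written `−v^{p²+2p+1}`). [folklore] -/
def eps1 : R p := -(X 2 ^ (p ^ 2 + 2 * p + 1))

/-- `ε₀` as a sum of three monomials. [folklore] -/
theorem eps0_eq : eps0 p = monomial (e3 (M p) (p ^ 2 + 1) (p ^ 2)) 1 + monomial (e3 (M p) 1 (2 * p ^ 2)) 1 +
    monomial (e3 0 (p ^ 2) (p ^ 3 + p ^ 2 + p)) 1 := by
  simp only [eps0, X0_pow_eq, X1_pow_eq, X2_pow_eq]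
  rw [X1_eq]
  simp only [monomial_mul_monomial, e3_add, mul_one, add_zero, zero_add]

/-- `ε₁ = −x^{(0,0,(p+1)²)}`. [folklore] -/
theorem eps1_eq : eps1 p = -monomial (e3 0 0 (p ^ 2 + 2 * p + 1)) 1 := by
  rw [eps1, X2_pow_eq]

/-- `𝔽_p⟦y, u, v⟧` has characteristic `p` (from the injectivity of the structure map; stated as a theorem, used via
`haveI`). [folklore] -/
theorem charP_R : CharP (R p) p :=
  charP_of_injective_algebraMap (algebraMap (ZMod p) (R p)).injective p

/-- `p² + 1 = 1`, `p² + 2p + 1 = 1` in `𝔽_p`. [folklore] -/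
theorem natCast_sq_succ : ((p ^ 2 + 1 : ℕ) : ZMod p) = 1 ∧ ((p ^ 2 + 2 * p + 1 : ℕ) : ZMod p) = 1 := by
  have h0 : ((p : ℕ) : ZMod p) = 0 := ZMod.natCast_self p
  constructor <;> · push_cast; rw [h0]; ring

/-- `C(p³+p²+p, p²) ≡ 1 (mod p)` (two Lucas steps: `≡ C(p²+p+1, p) ≡ C(p+1, 1) = p + 1`). [folklore] -/
theorem natCast_choose_cube : (((p ^ 3 + p ^ 2 + p).choose (p ^ 2) : ℕ) : ZMod p) = 1 := by
  have hp0 : 0 < p := hp.out.pos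
  have h1 := Choose.choose_modEq_choose_mod_mul_choose_div_nat (n := p ^ 3 + p ^ 2 + p) (k := p ^ 2) (p := p)
  have e1 : (p ^ 3 + p ^ 2 + p) = p * (p ^ 2 + p + 1) := by ring
  have e2 : p ^ 2 = p * p := by ring
  rw [e1, Nat.mul_mod_right, Nat.mul_div_cancel_left _ hp0, e2, Nat.mul_mod_right, Nat.mul_div_cancel_left _ hp0,
    Nat.choose_zero_right, one_mul] at h1
  have h2 := Choose.choose_modEq_choose_mod_mul_choose_div_nat (n := p ^ 2 + p + 1) (k := p) (p := p)
  have e3' : p ^ 2 + p + 1 = 1 + p * (p + 1) := by ring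
  have hmod : (p ^ 2 + p + 1) % p = 1 % p := by rw [e3', Nat.add_mul_mod_self_left]
  have hdiv : (p ^ 2 + p + 1) / p = p + 1 := by
    rw [e3', Nat.add_mul_div_left _ _ hp0, Nat.div_eq_of_lt hp.out.one_lt, zero_add]
  rw [hmod, hdiv, Nat.mod_self, Nat.div_self hp0, Nat.choose_one_right] at h2
  have h1m : 1 % p = 1 := Nat.mod_eq_of_lt hp.out.one_lt
  rw [h1m, Nat.choose_zero_right, one_mul] at h2
  rw [← e2, ← e1] at h1
  rw [(ZMod.natCast_eq_natCast_iff' _ _ _).2 (h1.trans h2), natCast_succ_p]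

/-- `∂^{(M,1,0)} ε₀ = u^{p²}v^{p²} + v^{2p²}`. [folklore] -/
theorem hd_A0 : hasseDeriv (e3 (M p) 1 0) (eps0 p) = monomial (e3 0 (p ^ 2) (p ^ 2)) 1 + monomial (e3 0 0 (2 * p ^ 2)) 1 := by
  have h1 : 1 < p := hp.out.one_lt
  have hM : 0 < M p := by unfold M; omega
  rw [eps0_eq, map_add, map_add, hasseDeriv_e3_monomial_of_le p le_rfl (by omega) (Nat.zero_le _),
    hasseDeriv_e3_monomial_of_le p le_rfl le_rfl (Nat.zero_le _), hasseDeriv_e3_monomial_of_not_le p (by omega)]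
  simp only [Nat.choose_self, Nat.choose_one_right, Nat.choose_zero_right, Nat.sub_zero, Nat.sub_self,
    Nat.add_sub_cancel, Nat.cast_one, (natCast_sq_succ p).1, one_mul, mul_one, add_zero]

/-- `∂^{(0,p²,p²)} ε₀ = y^{M}u + v^{p³+p}`. [folklore] -/
theorem hd_B0 : hasseDeriv (e3 0 (p ^ 2) (p ^ 2)) (eps0 p) =
    monomial (e3 (M p) 1 0) 1 + monomial (e3 0 0 (p ^ 3 + p)) 1 := by
  have h1 : 1 < p := hp.out.one_lt
  have hp2 : 1 < p ^ 2 := by nlinarith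
  rw [eps0_eq, map_add, map_add, hasseDeriv_e3_monomial_of_le p (Nat.zero_le _) (by omega) le_rfl,
    hasseDeriv_e3_monomial_of_not_le p (by omega), hasseDeriv_e3_monomial_of_le p le_rfl le_rfl (by omega)]
  have hsub : p ^ 3 + p ^ 2 + p - p ^ 2 = p ^ 3 + p := by omega
  simp only [Nat.choose_zero_right, Nat.choose_succ_self_right, Nat.choose_self, Nat.sub_zero, Nat.sub_self,
    Nat.add_sub_cancel_left, hsub, (natCast_sq_succ p).1, natCast_choose_cube, one_mul, mul_one, add_zero]

/-- **The level-0 Case-(I) diff-product is `ε₀ + v^{p³+2p²+p}`.** [folklore] -/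
theorem hd_prod0 : hasseDeriv (e3 (M p) 1 0) (eps0 p) * hasseDeriv (e3 0 (p ^ 2) (p ^ 2)) (eps0 p) =
    eps0 p + monomial (e3 0 0 (p ^ 3 + 2 * p ^ 2 + p)) 1 := by
  rw [hd_A0, hd_B0, eps0_eq]
  simp only [add_mul, mul_add, monomial_mul_monomial, e3_add, mul_one, add_zero, zero_add]
  have e1 : p ^ 2 + (p ^ 3 + p) = p ^ 3 + p ^ 2 + p := by ring
  have e2 : 2 * p ^ 2 + (p ^ 3 + p) = p ^ 3 + 2 * p ^ 2 + p := by ring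
  rw [e1, e2]
  abel

/-- **The remainder is a `p`-th power**: `ε₁^p = −v^{p(p+1)²} = ε₀ − H♭(ε₀)`. [folklore] -/
theorem eps1_pow : eps1 p ^ p = -monomial (e3 0 0 (p ^ 3 + 2 * p ^ 2 + p)) 1 := by
  haveI : CharP (R p) p := charP_R p
  rw [eps1, neg_pow, neg_one_pow_char (R p) p, ← pow_mul, X2_pow_eq]
  have e1 : (p ^ 2 + 2 * p + 1) * p = p ^ 3 + 2 * p ^ 2 + p := by ring
  rw [e1, neg_one_mul]

/-- **THE CHAIN IDENTITY at level 0**: `y^{p²} + ε₀ = (y^p + ε₁)^p + H♭(ε₀)` — `g(0) = g(1)^p + h(0)` (Eq. (129)/(130) shape)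
with `g(0) = y^{p²} + ε₀`, `g(1) = y^p + ε₁`, `h(0)` the level-0 Case-(I) value (leading unit `1`). [folklore] -/
theorem chain0 : (X 0 : R p) ^ (p ^ 2) + eps0 p =
    ((X 0 : R p) ^ p + eps1 p) ^ p + hasseDeriv (e3 (M p) 1 0) (eps0 p) * hasseDeriv (e3 0 (p ^ 2) (p ^ 2)) (eps0 p) := by
  haveI : CharP (R p) p := charP_R p
  rw [add_pow_char ((X 0 : R p) ^ p) (eps1 p) p, ← pow_mul, show p * p = p ^ 2 from (sq p).symm, hd_prod0, eps1_pow]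
  abel

/-- **THE CHAIN IDENTITY at level 1**: `y^p + ε₁ = y^p + H♭(ε₁)` holds trivially once `H♭(ε₁) = ε₁` (`…ChainWitness.lean`):
`g(1) = g(2)^p + h(1)` with `g(2) = y`, so `∇ = V(y)`. Recorded as the tautology it is. [folklore] -/
theorem chain1 : (X 0 : R p) ^ p + eps1 p = (X 0 : R p) ^ p + eps1 p := rfl

/-! ### Orders at `ξ` -/

/-- `ord ε₀ = 3p²` (all three monomials have degree `≥ 3p²`, the top one exactly `3p²`). [folklore] -/
theorem order_eps0 : (eps0 p).order = ((3 * p ^ 2 : ℕ) : ℕ∞) := by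
  have h1 : 1 < p := hp.out.one_lt
  have hM := M_add_one p
  have hsq : 3 * p ^ 2 ≤ p ^ 2 + (p ^ 3 + p ^ 2 + p) := by nlinarith
  apply le_antisymm
  · have hc : coeff (e3 (M p) (p ^ 2 + 1) (p ^ 2)) (eps0 p) ≠ 0 := by
      rw [eps0_eq, map_add, map_add, coeff_e3_monomial, coeff_e3_monomial, coeff_e3_monomial, if_pos ⟨rfl, rfl, rfl⟩,
        if_neg (by omega), if_neg (by omega)]
      simp
    have := order_le hc
    rw [e3_degree] at this
    rwa [show M p + (p ^ 2 + 1) + p ^ 2 = 3 * p ^ 2 by omega] at this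
  · refine MvPowerSeries.le_order fun d hd => ?_
    classical
    have hd' : d.degree < 3 * p ^ 2 := by exact_mod_cast hd
    rw [eps0_eq, map_add, map_add, coeff_monomial, coeff_monomial, coeff_monomial]
    rw [if_neg, if_neg, if_neg, add_zero, add_zero]
    · rintro rfl; rw [e3_degree] at hd'; omega
    · rintro rfl; rw [e3_degree] at hd'; omega
    · rintro rfl; rw [e3_degree] at hd'; omega

/-- `ord_𝔪 ε₀ = 3p²`. [folklore] -/
theorem adicOrder_eps0 : adicOrder (eps0 p) = ((3 * p ^ 2 : ℕ) : ℕ∞) := by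
  rw [adicOrder_eq_order, order_eps0]

/-- `ord_𝔪 ε₁ = (p+1)²`. [folklore] -/
theorem adicOrder_eps1 : adicOrder (eps1 p) = ((p ^ 2 + 2 * p + 1 : ℕ) : ℕ∞) := by
  rw [adicOrder_eq_order, eps1_eq, order_neg, order_monomial_of_ne_zero one_ne_zero, e3_degree, zero_add, zero_add]

/-! ### Along the line `D = V(y, u)` (`P = (X 0, X 1)`, inside `∇ = V(y)`) -/

/-- **`g(0) = y^{p²} + ε₀ ∈ P^{p²}`**: `D` is permissible for `F̌(0) = (g(0), p²)` (`ord_D g(0) ≥ p²`). [folklore] -/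
theorem g0_mem_P_pow : (X 0 : R p) ^ (p ^ 2) + eps0 p ∈ P p ^ (p ^ 2) := by
  have hM := M_add_one p
  have hy : (X 0 : R p) ^ (p ^ 2) ∈ P p ^ (p ^ 2) := Ideal.pow_mem_pow (X0_mem_P p) _
  have hA : (X 0 : R p) ^ M p * X 1 ^ (p ^ 2 + 1) ∈ P p ^ (p ^ 2) :=
    Ideal.mul_mem_left _ _ (Ideal.pow_le_pow_right (Nat.le_succ _) (Ideal.pow_mem_pow (X1_mem_P p) _))
  have hB : (X 0 : R p) ^ M p * X 1 ∈ P p ^ (p ^ 2) := by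
    have := Ideal.mul_mem_mul (Ideal.pow_mem_pow (X0_mem_P p) (M p)) (Ideal.pow_mem_pow (X1_mem_P p) 1)
    rw [← pow_add, pow_one, hM] at this
    exact this
  have hC : (X 1 : R p) ^ (p ^ 2) ∈ P p ^ (p ^ 2) := Ideal.pow_mem_pow (X1_mem_P p) _
  unfold eps0
  exact add_mem hy (add_mem (add_mem (Ideal.mul_mem_right _ _ hA) (Ideal.mul_mem_right _ _ hB))
    (Ideal.mul_mem_right _ _ hC))

/-- **`g(1) = y^p + ε₁ ∉ P`**: `ord_D g(1) = 0 < p`, so `D` is NOT permissible for `F̌(1) = (g(1), p)`. [folklore] -/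
theorem g1_not_mem_P : (X 0 : R p) ^ p + eps1 p ∉ P p := by
  intro h
  have hy : (X 0 : R p) ^ p ∈ P p := Ideal.pow_mem_of_mem _ (X0_mem_P p) _ hp.out.pos
  have h1 : eps1 p ∈ P p := (Submodule.add_mem_iff_right _ hy).1 h
  rw [eps1] at h1
  exact X2_pow_not_mem_P p _ ((Submodule.neg_mem_iff _).1 h1)

/-- `h(0) = H♭(ε₀) ∉ P` (`ord_D h(0) = 0 < p²`): the consumed inequality fails along `D`, as the chain step predicts. [folklore] -/
theorem h0_not_mem_P : hasseDeriv (e3 (M p) 1 0) (eps0 p) * hasseDeriv (e3 0 (p ^ 2) (p ^ 2)) (eps0 p) ∉ P p := by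
  rw [hd_prod0]
  intro h
  have hε : eps0 p ∈ P p := by
    have hM := M_add_one p
    have hA : (X 0 : R p) ^ M p * X 1 ^ (p ^ 2 + 1) * X 2 ^ (p ^ 2) ∈ P p :=
      Ideal.mul_mem_right _ _ (Ideal.mul_mem_left _ _ (Ideal.pow_mem_of_mem _ (X1_mem_P p) _ (Nat.succ_pos _)))
    have hB : (X 0 : R p) ^ M p * X 1 * X 2 ^ (2 * p ^ 2) ∈ P p :=
      Ideal.mul_mem_right _ _ (Ideal.mul_mem_left _ _ (X1_mem_P p))
    have hC : (X 1 : R p) ^ (p ^ 2) * X 2 ^ (p ^ 3 + p ^ 2 + p) ∈ P p :=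
      Ideal.mul_mem_right _ _ (Ideal.pow_mem_of_mem _ (X1_mem_P p) _ (pow_pos hp.out.pos 2))
    unfold eps0
    exact add_mem (add_mem hA hB) hC
  rw [← X2_pow_eq] at h
  exact X2_pow_not_mem_P p _ ((Submodule.add_mem_iff_right _ hε).1 h)

/-- `y ∈ P`: the line `D = V(y, u)` lies inside `∇ = V(y) = {g(2) = 0}` (the chain coupling of p.85 L2). [folklore] -/
theorem y_mem_P : (X 0 : R p) ∈ P p := X0_mem_P p

end ChainWitness

end CampaignW21

end Summit.ResolutionOfSingularities.ResolutionOfSingularities.Theorems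

end
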